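import Summits.BirchSwinnertonDyer.BirchSwinnertonDyer.Theorems.KolyvaginDepthDoorDepthTableSteinWuthrichRankThree
import Summits.BirchSwinnertonDyer.BirchSwinnertonDyer.Theorems.KolyvaginDepthDoorDepthTableSteinWuthrichRankThree5077a1TwistLValue
import Summits.BirchSwinnertonDyer.BirchSwinnertonDyer.Theorems.KolyvaginDepthDoorDepthTableSteinWuthrichRankThree11197a1
import Summits.BirchSwinnertonDyer.BirchSwinnertonDyer.Theorems.KolyvaginDepthDoorDepthTableSteinWuthrichRankThree11197a1TwistLValue
import Summits.BirchSwinnertonDyer.BirchSwinnertonDyer.Theorems.KolyvaginDepthDoorDepthTableSteinWuthrichRankThree16811a1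
import Summits.BirchSwinnertonDyer.BirchSwinnertonDyer.Theorems.KolyvaginDepthDoorDepthTableSteinWuthrichRankThree16811a1TwistLValue
import Summits.BirchSwinnertonDyer.BirchSwinnertonDyer.Theorems.KolyvaginDepthDoorDepthTableSteinWuthrichRankThree18097b1
import Summits.BirchSwinnertonDyer.BirchSwinnertonDyer.Theorems.KolyvaginDepthDoorDepthTableSteinWuthrichRankThree18097b1TwistLValue
import Summits.BirchSwinnertonDyer.BirchSwinnertonDyer.Theorems.KolyvaginDepthDoorDepthTableSteinWuthrichRankThree11642a1
import Summits.BirchSwinnertonDyer.BirchSwinnertonDyer.Theorems.KolyvaginDepthDoorDepthTableSteinWuthrichRankThree11642a1TwistLValue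
import Summits.BirchSwinnertonDyer.BirchSwinnertonDyer.Theorems.KolyvaginDepthDoorDepthTableSteinWuthrichTwistTolerance
import HarnessLib

/-!
# Route `KolyvaginDepthDoor`, crux `KolyvaginDepthSupplyKN` (stmt-BirchSwinnertonDyer-22820) —
# DEPTH TABLE v14/v15, the ODD-RANK rows WITH TOLERANCE (part 1): `ord_p(L(T,1)/Ω_T) ≤ 3` closes the crux at `5077a1`, `11197a1`, `16811a1`, `18097b1`, `11642a1`

Helper file of the lead prover of line `levelone` (kdd-p1 g19; `--supports stmt-BirchSwinnertonDyer-22820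
--as helper`); it closes nothing and BSD is NOT proved by it.

g18's `cruxBody_of_twistLValue` (and g19's for the `d_K = −8` rows) asked `ord_p(L(T,1)/Ω_T) ≤ 0` — i.e. `Ш(T)[p] = 0` for the rank-zero
Heegner twist `T`. The crux's clause at a rank-`3` curve only needs `#Sel_p(T) ≤ p³` (`C<label>.cruxBody_of_twistSelmer`), and `rank T = 0`:
by the generic `natCard_selmerGroup_le_pow_of_rankZero_LValue` (`…TwistTolerance`: `#Ш[p] ≤ p^{ord_p #Ш}`, Skinner 2016 Thm. C, GZK,
Kodaira–Néron) the WEAKER datum `ord_p(L(T,1)/Ω_T) ≤ 3` suffices — the crux instance at these curves survives `p³ ∣ #Ш_an(T)·Tam(T)`.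
Per curve (`C<label>.cruxBody_of_twistLValue_le_three`); CONDITIONAL on Stein–Wuthrich 2013 Thm. 1.1, W. Zhang 2014 L8.4 (1) / 9.1,
Skinner 2016 Thm. C, GZK by name; nothing class-wide (the open stub (S♭) is untouched); BSD is NOT proved by any of this.

References: [Skinner2016PacificMC] Thm. C; [Darmon2004] Thm. 3.22; [SteinWuthrich2013] Thm. 1.1; [WZhang2014] L8.4 (1), Thm. 9.1;
[SilvermanAEC2009] X.4.2.
-/

set_option linter.dupNamespace false

noncomputable section

open scoped Classical NumberField

namespace Summit.BirchSwinnertonDyer.BirchSwinnertonDyer.Theorems.KolyvaginDepthDoor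

open Literature.NumberTheory.EllipticCurves Literature.NumberTheory.EllipticCurves.ModularForms
  WeierstrassCurve NumberField IsDedekindDomain
open Summit.BirchSwinnertonDyer.BirchSwinnertonDyer.Theorems
open Summit.BirchSwinnertonDyer.BirchSwinnertonDyer.Rank2Observatory
open Summit.BirchSwinnertonDyer.BirchSwinnertonDyer.Rank1Residual
open Summit.BirchSwinnertonDyer.Rank1Residual.Additive

namespace C5077a1

/-- **THE CRUX AT `5077a1` WITH TOLERANCE: `ord_5(L(T,1)/Ω_T) ≤ 3` SUFFICES** (instead of `≤ 0`). For ONE imaginary quadratic `K` with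
`d_K = -7` and the minimal twist model `T₀ = [0, 0, 1, -343, -2144]` of `E^{(-7)}`: `L(T₀,1) ≠ 0` and `ord_5(L(T₀,1)/Ω_{T₀}) ≤ 3` give
`#Sel_5(T₀) ≤ 5³` (`natCard_selmerGroup_le_pow_of_rankZero_LValue`: `Ш(T)[5]` may have order up to `5³`), hence (`C5077a1.cruxBody_of_twistSelmer`, `hT : ≤ 5³`)
the CLAUSE of `KolyvaginDepthSupplyKN` at `W = 5077a1` VERBATIM. CONDITIONAL on Stein–Wuthrich Thm. 1.1, W. Zhang L8.4 (1) / 9.1, Skinner 2016 Thm. C,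
GZK by name and the two hypotheses; per curve; BSD is not proved by it. [cite: Skinner2016PacificMC, Thm. C (p. 173)] [cite: Darmon2004, Thm. 3.22]
[cite: SteinWuthrich2013, Thm. 1.1 (p. 1758)] [cite: WZhang2014, Lemma 8.4 (1) (p. 236), Thm. 9.1 (p. 240)] -/
theorem cruxBody_of_twistLValue_le_three
    (hSW : SteinWuthrich2013_sha_inf_torsionBy_eq_bot_of_two_le_rank)
    (h84 : Literature.NumberTheory.EllipticCurves.WZhang2014_lemma84_exists_minimal_kolyvaginClass_one_selmerCard)
    (hSk : Skinner2016_padicValRat_bsd_rank_zero) (hGZK : rank_eq_analyticRank_of_analyticRank_le_one)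
    (K : Type) [Field K] [NumberField K] (hK : IsImaginaryQuadratic K) (hD : NumberField.discr K = -7)
    (hL : haveI := isElliptic_twist7;
      ((⟨0, 0, 1, -343, -2144⟩ : WeierstrassCurve ℤ).map (Int.castRingHom ℚ)).entireLFunction 1 ≠ 0)
    (hval : haveI := isElliptic_twist7; haveI := isGloballyMinimal_twist7;
      ∀ q : ℚ, ((⟨0, 0, 1, -343, -2144⟩ : WeierstrassCurve ℤ).map (Int.castRingHom ℚ)).entireLFunction 1 /
          ((((⟨0, 0, 1, -343, -2144⟩ : WeierstrassCurve ℤ).map (Int.castRingHom ℚ)).realPeriodRat : ℝ) : ℂ) = (q : ℂ) →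
        padicValRat 5 q ≤ 3) :
    haveI := isElliptic_of_mem_atlasR3A00 mem_atlas;
    haveI := isGloballyMinimal_of_mem_atlasR3A00 mem_atlas;
    ∃ (p : ℕ) (hp : Fact p.Prime), 5 ≤ p ∧ (c5077a1.e.baseChange ℚ).HasGoodReductionAtPrime p ∧
      ¬ (p : ℤ) ∣ (c5077a1.e.baseChange ℚ).frobeniusTrace p ∧ (∀ n : ℕ, (c5077a1.e.baseChange ℚ).HasSurjectiveModNGaloisRep (p ^ n : ℕ)) ∧
      (∀ v : HeightOneSpectrum (𝓞 ℚ), (c5077a1.e.baseChange ℚ).HasMultiplicativeReductionAt v →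
        ¬ p ∣ (c5077a1.e.baseChange ℚ).ordMinimalDiscriminant v) ∧
      ∃ (K : Type) (_ : Field K) (_ : NumberField K), IsImaginaryQuadratic K ∧
        NumberField.discr K ≠ -3 ∧ NumberField.discr K ≠ -4 ∧
        ∃ (_ : NeZero ((c5077a1.e.baseChange ℚ).conductorNorm ℤ)), SatisfiesHeegnerHypothesis ((c5077a1.e.baseChange ℚ).conductorNorm ℤ) K ∧
        ∃ (Dt : ModularParametrizationData (c5077a1.e.baseChange ℚ) ((c5077a1.e.baseChange ℚ).conductorNorm ℤ)) (β : ℤ) (ι : K →+* ℂ) (n₁ : ℕ)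
          (d : KolyvaginHeegnerData Dt β ι n₁), Squarefree n₁ ∧
          (∀ q ∈ n₁.primeFactors, Zhang2014.IsKolyvaginPrime ((c5077a1.e.baseChange ℚ).conductorNorm ℤ) (c5077a1.e.baseChange ℚ) K p q) ∧
          d.kolyvaginClass hp.out 1 ≠ 0 ∧
          (n₁.primeFactors.card + 1 ≤ (c5077a1.e.baseChange ℚ).mordellWeilRank ∨
            (n₁.primeFactors.card ≤ (c5077a1.e.baseChange ℚ).mordellWeilRank ∧
              n₁.primeFactors.card + 1 ≤ ((c5077a1.e.baseChange ℚ).quadraticTwist (NumberField.discr K : ℚ)).mordellWeilRank)) := by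
  haveI := isElliptic_of_mem_atlasR3A00 mem_atlas
  haveI := isGloballyMinimal_of_mem_atlasR3A00 mem_atlas
  haveI := isElliptic_twist7
  haveI := isGloballyMinimal_twist7
  haveI := Fact.mk (by norm_num : Nat.Prime 5)
  haveI iq := Fact.mk (by norm_num : Nat.Prime 5077)
  have hirr : ((⟨0, 0, 1, -343, -2144⟩ : WeierstrassCurve ℤ).map (Int.castRingHom ℚ)).HasIrreducibleModPGaloisRep 5 :=
    hasIrreducibleModPGaloisRep_5_twist7
  have h1 : Nat.card (((⟨0, 0, 1, -343, -2144⟩ : WeierstrassCurve ℤ).map (Int.castRingHom ℚ)).selmerGroup (5 : ℕ)) ≤ 5 ^ 3 :=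
    natCard_selmerGroup_le_pow_of_rankZero_LValue hSk hGZK _ 5 (by norm_num) (Or.inl goodOrdinary_5_twist7) hirr
      ⟨5077, iq, by norm_num, hasMultiplicativeReductionAtPrime_5077_twist7.1, by rw [hasMultiplicativeReductionAtPrime_5077_twist7.2]; norm_num⟩
      kodairaNeron_5_twist7 hL 3 hval
  have h2 : Nat.card (((c5077a1.e.baseChange ℚ).quadraticTwist ((-7) : ℚ)).selmerGroup (5 : ℕ)) ≤ 5 ^ 3 := by
    rw [← natCard_selmerGroup_eq_of_variableChange (((5 : ℕ) : ℤ)) twist_smul_eq]; exact h1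
  refine cruxBody_of_twistSelmer hSW h84 K hK hD ?_
  have hcast : (NumberField.discr K : ℚ) = ((-7) : ℚ) := by rw [hD]; norm_num
  rw [hcast]; exact h2

end C5077a1

namespace C11197a1

/-- **THE CRUX AT `11197a1` WITH TOLERANCE: `ord_5(L(T,1)/Ω_T) ≤ 3` SUFFICES** (instead of `≤ 0`). For ONE imaginary quadratic `K` with
`d_K = -7` and the minimal twist model `T₀ = [1, 5, 1, -270, -86]` of `E^{(-7)}`: `L(T₀,1) ≠ 0` and `ord_5(L(T₀,1)/Ω_{T₀}) ≤ 3` give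
`#Sel_5(T₀) ≤ 5³` (`natCard_selmerGroup_le_pow_of_rankZero_LValue`: `Ш(T)[5]` may have order up to `5³`), hence (`C11197a1.cruxBody_of_twistSelmer`, `hT : ≤ 5³`)
the CLAUSE of `KolyvaginDepthSupplyKN` at `W = 11197a1` VERBATIM. CONDITIONAL on Stein–Wuthrich Thm. 1.1, W. Zhang L8.4 (1) / 9.1, Skinner 2016 Thm. C,
GZK by name and the two hypotheses; per curve; BSD is not proved by it. [cite: Skinner2016PacificMC, Thm. C (p. 173)] [cite: Darmon2004, Thm. 3.22]
[cite: SteinWuthrich2013, Thm. 1.1 (p. 1758)] [cite: WZhang2014, Lemma 8.4 (1) (p. 236), Thm. 9.1 (p. 240)] -/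
theorem cruxBody_of_twistLValue_le_three
    (hSW : SteinWuthrich2013_sha_inf_torsionBy_eq_bot_of_two_le_rank)
    (h84 : Literature.NumberTheory.EllipticCurves.WZhang2014_lemma84_exists_minimal_kolyvaginClass_one_selmerCard)
    (hSk : Skinner2016_padicValRat_bsd_rank_zero) (hGZK : rank_eq_analyticRank_of_analyticRank_le_one)
    (K : Type) [Field K] [NumberField K] (hK : IsImaginaryQuadratic K) (hD : NumberField.discr K = -7)
    (hL : haveI := isElliptic_twist7;
      ((⟨1, 5, 1, -270, -86⟩ : WeierstrassCurve ℤ).map (Int.castRingHom ℚ)).entireLFunction 1 ≠ 0)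
    (hval : haveI := isElliptic_twist7; haveI := isGloballyMinimal_twist7;
      ∀ q : ℚ, ((⟨1, 5, 1, -270, -86⟩ : WeierstrassCurve ℤ).map (Int.castRingHom ℚ)).entireLFunction 1 /
          ((((⟨1, 5, 1, -270, -86⟩ : WeierstrassCurve ℤ).map (Int.castRingHom ℚ)).realPeriodRat : ℝ) : ℂ) = (q : ℂ) →
        padicValRat 5 q ≤ 3) :
    haveI := isElliptic_of_mem_atlasR3A00 mem_atlas;
    haveI := isGloballyMinimal_of_mem_atlasR3A00 mem_atlas;
    ∃ (p : ℕ) (hp : Fact p.Prime), 5 ≤ p ∧ (c11197a1.e.baseChange ℚ).HasGoodReductionAtPrime p ∧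
      ¬ (p : ℤ) ∣ (c11197a1.e.baseChange ℚ).frobeniusTrace p ∧ (∀ n : ℕ, (c11197a1.e.baseChange ℚ).HasSurjectiveModNGaloisRep (p ^ n : ℕ)) ∧
      (∀ v : HeightOneSpectrum (𝓞 ℚ), (c11197a1.e.baseChange ℚ).HasMultiplicativeReductionAt v →
        ¬ p ∣ (c11197a1.e.baseChange ℚ).ordMinimalDiscriminant v) ∧
      ∃ (K : Type) (_ : Field K) (_ : NumberField K), IsImaginaryQuadratic K ∧
        NumberField.discr K ≠ -3 ∧ NumberField.discr K ≠ -4 ∧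
        ∃ (_ : NeZero ((c11197a1.e.baseChange ℚ).conductorNorm ℤ)), SatisfiesHeegnerHypothesis ((c11197a1.e.baseChange ℚ).conductorNorm ℤ) K ∧
        ∃ (Dt : ModularParametrizationData (c11197a1.e.baseChange ℚ) ((c11197a1.e.baseChange ℚ).conductorNorm ℤ)) (β : ℤ) (ι : K →+* ℂ) (n₁ : ℕ)
          (d : KolyvaginHeegnerData Dt β ι n₁), Squarefree n₁ ∧
          (∀ q ∈ n₁.primeFactors, Zhang2014.IsKolyvaginPrime ((c11197a1.e.baseChange ℚ).conductorNorm ℤ) (c11197a1.e.baseChange ℚ) K p q) ∧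
          d.kolyvaginClass hp.out 1 ≠ 0 ∧
          (n₁.primeFactors.card + 1 ≤ (c11197a1.e.baseChange ℚ).mordellWeilRank ∨
            (n₁.primeFactors.card ≤ (c11197a1.e.baseChange ℚ).mordellWeilRank ∧
              n₁.primeFactors.card + 1 ≤ ((c11197a1.e.baseChange ℚ).quadraticTwist (NumberField.discr K : ℚ)).mordellWeilRank)) := by
  haveI := isElliptic_of_mem_atlasR3A00 mem_atlas
  haveI := isGloballyMinimal_of_mem_atlasR3A00 mem_atlas
  haveI := isElliptic_twist7
  haveI := isGloballyMinimal_twist7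
  haveI := Fact.mk (by norm_num : Nat.Prime 5)
  haveI iq := Fact.mk (by norm_num : Nat.Prime 11197)
  have hirr : ((⟨1, 5, 1, -270, -86⟩ : WeierstrassCurve ℤ).map (Int.castRingHom ℚ)).HasIrreducibleModPGaloisRep 5 :=
    hasIrreducibleModPGaloisRep_5_twist7
  have h1 : Nat.card (((⟨1, 5, 1, -270, -86⟩ : WeierstrassCurve ℤ).map (Int.castRingHom ℚ)).selmerGroup (5 : ℕ)) ≤ 5 ^ 3 :=
    natCard_selmerGroup_le_pow_of_rankZero_LValue hSk hGZK _ 5 (by norm_num) (Or.inl goodOrdinary_5_twist7) hirr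
      ⟨11197, iq, by norm_num, hasMultiplicativeReductionAtPrime_11197_twist7.1, by rw [hasMultiplicativeReductionAtPrime_11197_twist7.2]; norm_num⟩
      kodairaNeron_5_twist7 hL 3 hval
  have h2 : Nat.card (((c11197a1.e.baseChange ℚ).quadraticTwist ((-7) : ℚ)).selmerGroup (5 : ℕ)) ≤ 5 ^ 3 := by
    rw [← natCard_selmerGroup_eq_of_variableChange (((5 : ℕ) : ℤ)) twist_smul_eq]; exact h1
  refine cruxBody_of_twistSelmer hSW h84 K hK hD ?_
  have hcast : (NumberField.discr K : ℚ) = ((-7) : ℚ) := by rw [hD]; norm_num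
  rw [hcast]; exact h2

end C11197a1

namespace C16811a1

/-- **THE CRUX AT `16811a1` WITH TOLERANCE: `ord_5(L(T,1)/Ω_T) ≤ 3` SUFFICES** (instead of `≤ 0`). For ONE imaginary quadratic `K` with
`d_K = -7` and the minimal twist model `T₀ = [0, 0, 1, -49, -2144]` of `E^{(-7)}`: `L(T₀,1) ≠ 0` and `ord_5(L(T₀,1)/Ω_{T₀}) ≤ 3` give
`#Sel_5(T₀) ≤ 5³` (`natCard_selmerGroup_le_pow_of_rankZero_LValue`: `Ш(T)[5]` may have order up to `5³`), hence (`C16811a1.cruxBody_of_twistSelmer`, `hT : ≤ 5³`)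
the CLAUSE of `KolyvaginDepthSupplyKN` at `W = 16811a1` VERBATIM. CONDITIONAL on Stein–Wuthrich Thm. 1.1, W. Zhang L8.4 (1) / 9.1, Skinner 2016 Thm. C,
GZK by name and the two hypotheses; per curve; BSD is not proved by it. [cite: Skinner2016PacificMC, Thm. C (p. 173)] [cite: Darmon2004, Thm. 3.22]
[cite: SteinWuthrich2013, Thm. 1.1 (p. 1758)] [cite: WZhang2014, Lemma 8.4 (1) (p. 236), Thm. 9.1 (p. 240)] -/
theorem cruxBody_of_twistLValue_le_three
    (hSW : SteinWuthrich2013_sha_inf_torsionBy_eq_bot_of_two_le_rank)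
    (h84 : Literature.NumberTheory.EllipticCurves.WZhang2014_lemma84_exists_minimal_kolyvaginClass_one_selmerCard)
    (hSk : Skinner2016_padicValRat_bsd_rank_zero) (hGZK : rank_eq_analyticRank_of_analyticRank_le_one)
    (K : Type) [Field K] [NumberField K] (hK : IsImaginaryQuadratic K) (hD : NumberField.discr K = -7)
    (hL : haveI := isElliptic_twist7;
      ((⟨0, 0, 1, -49, -2144⟩ : WeierstrassCurve ℤ).map (Int.castRingHom ℚ)).entireLFunction 1 ≠ 0)
    (hval : haveI := isElliptic_twist7; haveI := isGloballyMinimal_twist7;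
      ∀ q : ℚ, ((⟨0, 0, 1, -49, -2144⟩ : WeierstrassCurve ℤ).map (Int.castRingHom ℚ)).entireLFunction 1 /
          ((((⟨0, 0, 1, -49, -2144⟩ : WeierstrassCurve ℤ).map (Int.castRingHom ℚ)).realPeriodRat : ℝ) : ℂ) = (q : ℂ) →
        padicValRat 5 q ≤ 3) :
    haveI := isElliptic_of_mem_atlasR3A00 mem_atlas;
    haveI := isGloballyMinimal_of_mem_atlasR3A00 mem_atlas;
    ∃ (p : ℕ) (hp : Fact p.Prime), 5 ≤ p ∧ (c16811a1.e.baseChange ℚ).HasGoodReductionAtPrime p ∧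
      ¬ (p : ℤ) ∣ (c16811a1.e.baseChange ℚ).frobeniusTrace p ∧ (∀ n : ℕ, (c16811a1.e.baseChange ℚ).HasSurjectiveModNGaloisRep (p ^ n : ℕ)) ∧
      (∀ v : HeightOneSpectrum (𝓞 ℚ), (c16811a1.e.baseChange ℚ).HasMultiplicativeReductionAt v →
        ¬ p ∣ (c16811a1.e.baseChange ℚ).ordMinimalDiscriminant v) ∧
      ∃ (K : Type) (_ : Field K) (_ : NumberField K), IsImaginaryQuadratic K ∧
        NumberField.discr K ≠ -3 ∧ NumberField.discr K ≠ -4 ∧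
        ∃ (_ : NeZero ((c16811a1.e.baseChange ℚ).conductorNorm ℤ)), SatisfiesHeegnerHypothesis ((c16811a1.e.baseChange ℚ).conductorNorm ℤ) K ∧
        ∃ (Dt : ModularParametrizationData (c16811a1.e.baseChange ℚ) ((c16811a1.e.baseChange ℚ).conductorNorm ℤ)) (β : ℤ) (ι : K →+* ℂ) (n₁ : ℕ)
          (d : KolyvaginHeegnerData Dt β ι n₁), Squarefree n₁ ∧
          (∀ q ∈ n₁.primeFactors, Zhang2014.IsKolyvaginPrime ((c16811a1.e.baseChange ℚ).conductorNorm ℤ) (c16811a1.e.baseChange ℚ) K p q) ∧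
          d.kolyvaginClass hp.out 1 ≠ 0 ∧
          (n₁.primeFactors.card + 1 ≤ (c16811a1.e.baseChange ℚ).mordellWeilRank ∨
            (n₁.primeFactors.card ≤ (c16811a1.e.baseChange ℚ).mordellWeilRank ∧
              n₁.primeFactors.card + 1 ≤ ((c16811a1.e.baseChange ℚ).quadraticTwist (NumberField.discr K : ℚ)).mordellWeilRank)) := by
  haveI := isElliptic_of_mem_atlasR3A00 mem_atlas
  haveI := isGloballyMinimal_of_mem_atlasR3A00 mem_atlas
  haveI := isElliptic_twist7
  haveI := isGloballyMinimal_twist7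
  haveI := Fact.mk (by norm_num : Nat.Prime 5)
  haveI iq := Fact.mk (by norm_num : Nat.Prime 16811)
  have hirr : ((⟨0, 0, 1, -49, -2144⟩ : WeierstrassCurve ℤ).map (Int.castRingHom ℚ)).HasIrreducibleModPGaloisRep 5 :=
    hasIrreducibleModPGaloisRep_5_twist7
  have h1 : Nat.card (((⟨0, 0, 1, -49, -2144⟩ : WeierstrassCurve ℤ).map (Int.castRingHom ℚ)).selmerGroup (5 : ℕ)) ≤ 5 ^ 3 :=
    natCard_selmerGroup_le_pow_of_rankZero_LValue hSk hGZK _ 5 (by norm_num) (Or.inl goodOrdinary_5_twist7) hirr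
      ⟨16811, iq, by norm_num, hasMultiplicativeReductionAtPrime_16811_twist7.1, by rw [hasMultiplicativeReductionAtPrime_16811_twist7.2]; norm_num⟩
      kodairaNeron_5_twist7 hL 3 hval
  have h2 : Nat.card (((c16811a1.e.baseChange ℚ).quadraticTwist ((-7) : ℚ)).selmerGroup (5 : ℕ)) ≤ 5 ^ 3 := by
    rw [← natCard_selmerGroup_eq_of_variableChange (((5 : ℕ) : ℤ)) twist_smul_eq]; exact h1
  refine cruxBody_of_twistSelmer hSW h84 K hK hD ?_
  have hcast : (NumberField.discr K : ℚ) = ((-7) : ℚ) := by rw [hD]; norm_num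
  rw [hcast]; exact h2

end C16811a1

namespace C18097b1

/-- **THE CRUX AT `18097b1` WITH TOLERANCE: `ord_5(L(T,1)/Ω_T) ≤ 3` SUFFICES** (instead of `≤ 0`). For ONE imaginary quadratic `K` with
`d_K = -7` and the minimal twist model `T₀ = [1, -9, 1, -466, -2144]` of `E^{(-7)}`: `L(T₀,1) ≠ 0` and `ord_5(L(T₀,1)/Ω_{T₀}) ≤ 3` give
`#Sel_5(T₀) ≤ 5³` (`natCard_selmerGroup_le_pow_of_rankZero_LValue`: `Ш(T)[5]` may have order up to `5³`), hence (`C18097b1.cruxBody_of_twistSelmer`, `hT : ≤ 5³`)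
the CLAUSE of `KolyvaginDepthSupplyKN` at `W = 18097b1` VERBATIM. CONDITIONAL on Stein–Wuthrich Thm. 1.1, W. Zhang L8.4 (1) / 9.1, Skinner 2016 Thm. C,
GZK by name and the two hypotheses; per curve; BSD is not proved by it. [cite: Skinner2016PacificMC, Thm. C (p. 173)] [cite: Darmon2004, Thm. 3.22]
[cite: SteinWuthrich2013, Thm. 1.1 (p. 1758)] [cite: WZhang2014, Lemma 8.4 (1) (p. 236), Thm. 9.1 (p. 240)] -/
theorem cruxBody_of_twistLValue_le_three
    (hSW : SteinWuthrich2013_sha_inf_torsionBy_eq_bot_of_two_le_rank)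
    (h84 : Literature.NumberTheory.EllipticCurves.WZhang2014_lemma84_exists_minimal_kolyvaginClass_one_selmerCard)
    (hSk : Skinner2016_padicValRat_bsd_rank_zero) (hGZK : rank_eq_analyticRank_of_analyticRank_le_one)
    (K : Type) [Field K] [NumberField K] (hK : IsImaginaryQuadratic K) (hD : NumberField.discr K = -7)
    (hL : haveI := isElliptic_twist7;
      ((⟨1, -9, 1, -466, -2144⟩ : WeierstrassCurve ℤ).map (Int.castRingHom ℚ)).entireLFunction 1 ≠ 0)
    (hval : haveI := isElliptic_twist7; haveI := isGloballyMinimal_twist7;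
      ∀ q : ℚ, ((⟨1, -9, 1, -466, -2144⟩ : WeierstrassCurve ℤ).map (Int.castRingHom ℚ)).entireLFunction 1 /
          ((((⟨1, -9, 1, -466, -2144⟩ : WeierstrassCurve ℤ).map (Int.castRingHom ℚ)).realPeriodRat : ℝ) : ℂ) = (q : ℂ) →
        padicValRat 5 q ≤ 3) :
    haveI := isElliptic_of_mem_atlasR3A00 mem_atlas;
    haveI := isGloballyMinimal_of_mem_atlasR3A00 mem_atlas;
    ∃ (p : ℕ) (hp : Fact p.Prime), 5 ≤ p ∧ (c18097b1.e.baseChange ℚ).HasGoodReductionAtPrime p ∧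
      ¬ (p : ℤ) ∣ (c18097b1.e.baseChange ℚ).frobeniusTrace p ∧ (∀ n : ℕ, (c18097b1.e.baseChange ℚ).HasSurjectiveModNGaloisRep (p ^ n : ℕ)) ∧
      (∀ v : HeightOneSpectrum (𝓞 ℚ), (c18097b1.e.baseChange ℚ).HasMultiplicativeReductionAt v →
        ¬ p ∣ (c18097b1.e.baseChange ℚ).ordMinimalDiscriminant v) ∧
      ∃ (K : Type) (_ : Field K) (_ : NumberField K), IsImaginaryQuadratic K ∧
        NumberField.discr K ≠ -3 ∧ NumberField.discr K ≠ -4 ∧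
        ∃ (_ : NeZero ((c18097b1.e.baseChange ℚ).conductorNorm ℤ)), SatisfiesHeegnerHypothesis ((c18097b1.e.baseChange ℚ).conductorNorm ℤ) K ∧
        ∃ (Dt : ModularParametrizationData (c18097b1.e.baseChange ℚ) ((c18097b1.e.baseChange ℚ).conductorNorm ℤ)) (β : ℤ) (ι : K →+* ℂ) (n₁ : ℕ)
          (d : KolyvaginHeegnerData Dt β ι n₁), Squarefree n₁ ∧
          (∀ q ∈ n₁.primeFactors, Zhang2014.IsKolyvaginPrime ((c18097b1.e.baseChange ℚ).conductorNorm ℤ) (c18097b1.e.baseChange ℚ) K p q) ∧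
          d.kolyvaginClass hp.out 1 ≠ 0 ∧
          (n₁.primeFactors.card + 1 ≤ (c18097b1.e.baseChange ℚ).mordellWeilRank ∨
            (n₁.primeFactors.card ≤ (c18097b1.e.baseChange ℚ).mordellWeilRank ∧
              n₁.primeFactors.card + 1 ≤ ((c18097b1.e.baseChange ℚ).quadraticTwist (NumberField.discr K : ℚ)).mordellWeilRank)) := by
  haveI := isElliptic_of_mem_atlasR3A00 mem_atlas
  haveI := isGloballyMinimal_of_mem_atlasR3A00 mem_atlas
  haveI := isElliptic_twist7
  haveI := isGloballyMinimal_twist7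
  haveI := Fact.mk (by norm_num : Nat.Prime 5)
  haveI iq := Fact.mk (by norm_num : Nat.Prime 18097)
  have hirr : ((⟨1, -9, 1, -466, -2144⟩ : WeierstrassCurve ℤ).map (Int.castRingHom ℚ)).HasIrreducibleModPGaloisRep 5 :=
    hasIrreducibleModPGaloisRep_5_twist7
  have h1 : Nat.card (((⟨1, -9, 1, -466, -2144⟩ : WeierstrassCurve ℤ).map (Int.castRingHom ℚ)).selmerGroup (5 : ℕ)) ≤ 5 ^ 3 :=
    natCard_selmerGroup_le_pow_of_rankZero_LValue hSk hGZK _ 5 (by norm_num) (Or.inl goodOrdinary_5_twist7) hirr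
      ⟨18097, iq, by norm_num, hasMultiplicativeReductionAtPrime_18097_twist7.1, by rw [hasMultiplicativeReductionAtPrime_18097_twist7.2]; norm_num⟩
      kodairaNeron_5_twist7 hL 3 hval
  have h2 : Nat.card (((c18097b1.e.baseChange ℚ).quadraticTwist ((-7) : ℚ)).selmerGroup (5 : ℕ)) ≤ 5 ^ 3 := by
    rw [← natCard_selmerGroup_eq_of_variableChange (((5 : ℕ) : ℤ)) twist_smul_eq]; exact h1
  refine cruxBody_of_twistSelmer hSW h84 K hK hD ?_
  have hcast : (NumberField.discr K : ℚ) = ((-7) : ℚ) := by rw [hD]; norm_num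
  rw [hcast]; exact h2

end C18097b1

namespace C11642a1

/-- **THE CRUX AT `11642a1` WITH TOLERANCE: `ord_5(L(T,1)/Ω_T) ≤ 3` SUFFICES** (instead of `≤ 0`). For ONE imaginary quadratic `K` with
`d_K = -7` and the minimal twist model `T₀ = [1, 5, 0, -784, -9604]` of `E^{(-7)}`: `L(T₀,1) ≠ 0` and `ord_5(L(T₀,1)/Ω_{T₀}) ≤ 3` give
`#Sel_5(T₀) ≤ 5³` (`natCard_selmerGroup_le_pow_of_rankZero_LValue`: `Ш(T)[5]` may have order up to `5³`), hence (`C11642a1.cruxBody_of_twistSelmer`, `hT : ≤ 5³`)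
the CLAUSE of `KolyvaginDepthSupplyKN` at `W = 11642a1` VERBATIM. CONDITIONAL on Stein–Wuthrich Thm. 1.1, W. Zhang L8.4 (1) / 9.1, Skinner 2016 Thm. C,
GZK by name and the two hypotheses; per curve; BSD is not proved by it. [cite: Skinner2016PacificMC, Thm. C (p. 173)] [cite: Darmon2004, Thm. 3.22]
[cite: SteinWuthrich2013, Thm. 1.1 (p. 1758)] [cite: WZhang2014, Lemma 8.4 (1) (p. 236), Thm. 9.1 (p. 240)] -/
theorem cruxBody_of_twistLValue_le_three
    (hSW : SteinWuthrich2013_sha_inf_torsionBy_eq_bot_of_two_le_rank)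
    (h84 : Literature.NumberTheory.EllipticCurves.WZhang2014_lemma84_exists_minimal_kolyvaginClass_one_selmerCard)
    (hSk : Skinner2016_padicValRat_bsd_rank_zero) (hGZK : rank_eq_analyticRank_of_analyticRank_le_one)
    (K : Type) [Field K] [NumberField K] (hK : IsImaginaryQuadratic K) (hD : NumberField.discr K = -7)
    (hL : haveI := isElliptic_twist7;
      ((⟨1, 5, 0, -784, -9604⟩ : WeierstrassCurve ℤ).map (Int.castRingHom ℚ)).entireLFunction 1 ≠ 0)
    (hval : haveI := isElliptic_twist7; haveI := isGloballyMinimal_twist7;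
      ∀ q : ℚ, ((⟨1, 5, 0, -784, -9604⟩ : WeierstrassCurve ℤ).map (Int.castRingHom ℚ)).entireLFunction 1 /
          ((((⟨1, 5, 0, -784, -9604⟩ : WeierstrassCurve ℤ).map (Int.castRingHom ℚ)).realPeriodRat : ℝ) : ℂ) = (q : ℂ) →
        padicValRat 5 q ≤ 3) :
    haveI := isElliptic_of_mem_atlasR3A00 mem_atlas;
    haveI := isGloballyMinimal_of_mem_atlasR3A00 mem_atlas;
    ∃ (p : ℕ) (hp : Fact p.Prime), 5 ≤ p ∧ (c11642a1.e.baseChange ℚ).HasGoodReductionAtPrime p ∧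
      ¬ (p : ℤ) ∣ (c11642a1.e.baseChange ℚ).frobeniusTrace p ∧ (∀ n : ℕ, (c11642a1.e.baseChange ℚ).HasSurjectiveModNGaloisRep (p ^ n : ℕ)) ∧
      (∀ v : HeightOneSpectrum (𝓞 ℚ), (c11642a1.e.baseChange ℚ).HasMultiplicativeReductionAt v →
        ¬ p ∣ (c11642a1.e.baseChange ℚ).ordMinimalDiscriminant v) ∧
      ∃ (K : Type) (_ : Field K) (_ : NumberField K), IsImaginaryQuadratic K ∧
        NumberField.discr K ≠ -3 ∧ NumberField.discr K ≠ -4 ∧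
        ∃ (_ : NeZero ((c11642a1.e.baseChange ℚ).conductorNorm ℤ)), SatisfiesHeegnerHypothesis ((c11642a1.e.baseChange ℚ).conductorNorm ℤ) K ∧
        ∃ (Dt : ModularParametrizationData (c11642a1.e.baseChange ℚ) ((c11642a1.e.baseChange ℚ).conductorNorm ℤ)) (β : ℤ) (ι : K →+* ℂ) (n₁ : ℕ)
          (d : KolyvaginHeegnerData Dt β ι n₁), Squarefree n₁ ∧
          (∀ q ∈ n₁.primeFactors, Zhang2014.IsKolyvaginPrime ((c11642a1.e.baseChange ℚ).conductorNorm ℤ) (c11642a1.e.baseChange ℚ) K p q) ∧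
          d.kolyvaginClass hp.out 1 ≠ 0 ∧
          (n₁.primeFactors.card + 1 ≤ (c11642a1.e.baseChange ℚ).mordellWeilRank ∨
            (n₁.primeFactors.card ≤ (c11642a1.e.baseChange ℚ).mordellWeilRank ∧
              n₁.primeFactors.card + 1 ≤ ((c11642a1.e.baseChange ℚ).quadraticTwist (NumberField.discr K : ℚ)).mordellWeilRank)) := by
  haveI := isElliptic_of_mem_atlasR3A00 mem_atlas
  haveI := isGloballyMinimal_of_mem_atlasR3A00 mem_atlas
  haveI := isElliptic_twist7
  haveI := isGloballyMinimal_twist7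
  haveI := Fact.mk (by norm_num : Nat.Prime 5)
  haveI iq := Fact.mk (by norm_num : Nat.Prime 5821)
  have hirr : ((⟨1, 5, 0, -784, -9604⟩ : WeierstrassCurve ℤ).map (Int.castRingHom ℚ)).HasIrreducibleModPGaloisRep 5 :=
    hasIrreducibleModPGaloisRep_5_twist7
  have h1 : Nat.card (((⟨1, 5, 0, -784, -9604⟩ : WeierstrassCurve ℤ).map (Int.castRingHom ℚ)).selmerGroup (5 : ℕ)) ≤ 5 ^ 3 :=
    natCard_selmerGroup_le_pow_of_rankZero_LValue hSk hGZK _ 5 (by norm_num) (Or.inl goodOrdinary_5_twist7) hirr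
      ⟨5821, iq, by norm_num, hasMultiplicativeReductionAtPrime_5821_twist7.1, by rw [hasMultiplicativeReductionAtPrime_5821_twist7.2]; norm_num⟩
      kodairaNeron_5_twist7 hL 3 hval
  have h2 : Nat.card (((c11642a1.e.baseChange ℚ).quadraticTwist ((-7) : ℚ)).selmerGroup (5 : ℕ)) ≤ 5 ^ 3 := by
    rw [← natCard_selmerGroup_eq_of_variableChange (((5 : ℕ) : ℤ)) twist_smul_eq]; exact h1
  refine cruxBody_of_twistSelmer hSW h84 K hK hD ?_
  have hcast : (NumberField.discr K : ℚ) = ((-7) : ℚ) := by rw [hD]; norm_num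
  rw [hcast]; exact h2

end C11642a1

end Summit.BirchSwinnertonDyer.BirchSwinnertonDyer.Theorems.KolyvaginDepthDoor

end
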